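import Summits.AtomisticToContinuum.HydrodynamicLimit.Theorems.JParityClosureOddContactSymmetryGibbsInvariance
import HarnessLib

/-!
# Markov over windows at rung 0: the number of window starts falling into a bad static event is small in probability
# (helper file, `--supports stmt-AtomisticToContinuum-13080`)

Crux `JParityClosure.RateFloor` (stmt-AtomisticToContinuum-13080), line `Sketch`, rung-0 stub `stub_staticOpacityFloorRung0` — the W-side
device that replaces a union bound over the `K = ⌊τ/Δ⌋` windows (which needs per-window failure probabilities `o(1/K)`, i.e. `b < 2/3`
with Chebyshev) by MARKOV's inequality on the NUMBER of bad windows: for constant profiles `G_N` is `Φ_t`-invariant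
(`localGibbsLaw_const_preimage_flow`), so for a measurable static event `Bad`, window starts `t_k` (`k < K`) and a level `c > 0`,

  `G_N {z | c ≤ #{k < K : Φ_{t_k} z ∈ Bad}} ≤ K · G_N(Bad) / c`     (`measure_le_card_windows_mem_le`).

With `c = fK`: outside an event of probability `≤ G_N(Bad)/f` at least `(1 − f)K` window starts are good; good windows carry their
static floor and bad windows contribute `≥ 0` to a nonnegative window sum.  Any per-window bound `G_N(Bad) → 0` (e.g. Chebyshev with
relative variance `→ 0`, every `b < 4/3`) therefore suffices — no union bound.
-/

noncomputable section

open MeasureTheory ProbabilityTheory Set Filter Topology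
open scoped ENNReal BigOperators

namespace Summit.AtomisticToContinuum.HydrodynamicLimit.Theorems

namespace RateFloorMarkovWindows

open Literature.Analysis.FluidPDE Literature.MathematicalPhysics.KineticTheory

/-- **Markov over windows at rung 0.**  Constant profiles, a flow `Φ`, a measurable static event `Bad`, window start times
`t : Fin K → ℝ` and a level `0 < c`:
`G_N {z | c ≤ Σ_k 𝟙_Bad(Φ_{t_k} z)} ≤ (K · G_N(Bad)) / ofReal c` (the expected number of bad window starts is `K · G_N(Bad)` by
invariance; Markov). [folklore] -/
theorem measure_le_card_windows_mem_le (σ a θ : ℝ) (u : V3) (N : ℕ)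
    (Φ : HardSphereFlow (Torus.geometry (Fin 3)) (hsDiameter σ N) (N + 1)) {Bad : Set (Config (N + 1) (Fin 3) T3)}
    (hBad : MeasurableSet Bad) {K : ℕ} (t : Fin K → ℝ) {c : ℝ} (hc : 0 < c) :
    localGibbsLaw σ (fun _ => a) (fun _ => u) (fun _ => θ) N Φ
        {z | c ≤ ∑ k : Fin K, Bad.indicator (fun _ => (1 : ℝ)) (Φ.flow (t k) z)} ≤
      ((K : ℝ≥0∞) * localGibbsLaw σ (fun _ => a) (fun _ => u) (fun _ => θ) N Φ Bad) / ENNReal.ofReal c := by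
  classical
  set G := localGibbsLaw σ (fun _ => a) (fun _ => u) (fun _ => θ) N Φ with hG
  -- the counting function in `ℝ≥0∞`
  set F : Config (N + 1) (Fin 3) T3 → ℝ≥0∞ := fun z => ∑ k : Fin K, (Φ.flow (t k) ⁻¹' Bad).indicator (fun _ => (1 : ℝ≥0∞)) z
    with hF
  have hpre : ∀ k : Fin K, MeasurableSet (Φ.flow (t k) ⁻¹' Bad) := fun k => Φ.measurable_flow (t k) hBad
  have hFm : Measurable F := Finset.measurable_sum _ fun k _ => measurable_one.indicator (hpre k)
  -- its integral is `K · G(Bad)` by invariance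
  have hFint : ∫⁻ z, F z ∂G = K * G Bad := by
    have h1 : ∫⁻ z, F z ∂G = ∑ k : Fin K, ∫⁻ z, (Φ.flow (t k) ⁻¹' Bad).indicator (fun _ => (1 : ℝ≥0∞)) z ∂G :=
      lintegral_finsetSum Finset.univ (fun k _ => measurable_one.indicator (hpre k))
    have hk : ∀ k : Fin K, ∫⁻ z, (Φ.flow (t k) ⁻¹' Bad).indicator (fun _ => (1 : ℝ≥0∞)) z ∂G = G Bad := fun k => by
      rw [lintegral_indicator (hpre k), setLIntegral_const, one_mul, hG,
        localGibbsLaw_const_preimage_flow σ a θ u N Φ (t k) hBad]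
    rw [h1]
    simp only [hk, Finset.sum_const, Finset.card_univ, Fintype.card_fin, nsmul_eq_mul]
  -- the real count is the `toReal` of `F`, so the event is `{ofReal c ≤ F}`
  have hcount : ∀ z, ENNReal.ofReal (∑ k : Fin K, Bad.indicator (fun _ => (1 : ℝ)) (Φ.flow (t k) z)) = F z := by
    intro z
    simp only [hF]
    rw [ENNReal.ofReal_sum_of_nonneg (fun k _ => Set.indicator_nonneg (fun _ _ => zero_le_one) _)]
    refine Finset.sum_congr rfl fun k _ => ?_
    by_cases hz : Φ.flow (t k) z ∈ Bad
    · rw [Set.indicator_of_mem hz, Set.indicator_of_mem (show z ∈ Φ.flow (t k) ⁻¹' Bad from hz), ENNReal.ofReal_one]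
    · rw [Set.indicator_of_notMem hz, Set.indicator_of_notMem (show z ∉ Φ.flow (t k) ⁻¹' Bad from hz), ENNReal.ofReal_zero]
  have hsub : {z | c ≤ ∑ k : Fin K, Bad.indicator (fun _ => (1 : ℝ)) (Φ.flow (t k) z)} ⊆ {z | ENNReal.ofReal c ≤ F z} := by
    intro z hz
    simp only [mem_setOf_eq] at hz ⊢
    rw [← hcount z]
    exact ENNReal.ofReal_le_ofReal hz
  have hc' : ENNReal.ofReal c ≠ 0 := (ENNReal.ofReal_pos.2 hc).ne'
  calc G {z | c ≤ ∑ k : Fin K, Bad.indicator (fun _ => (1 : ℝ)) (Φ.flow (t k) z)}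
      ≤ G {z | ENNReal.ofReal c ≤ F z} := measure_mono hsub
    _ ≤ (∫⁻ z, F z ∂G) / ENNReal.ofReal c := meas_ge_le_lintegral_div hFm.aemeasurable hc' ENNReal.ofReal_ne_top
    _ = ((K : ℝ≥0∞) * G Bad) / ENNReal.ofReal c := by rw [hFint]

/-- Registered stub `stub_markovWindowsRung0` of crux stmt-AtomisticToContinuum-13080 (line `Sketch`, c2 lane): the closed form of
`measure_le_card_windows_mem_le`. -/
theorem stub_markovWindowsRung0 : ∀ (σ a θ : ℝ) (u : V3) (N : ℕ) (Φ : HardSphereFlow (Torus.geometry (Fin 3)) (hsDiameter σ N) (N + 1)) (Bad : Set (Config (N + 1) (Fin 3) T3)), MeasurableSet Bad → ∀ (K : ℕ) (t : Fin K → ℝ) (c : ℝ), 0 < c → localGibbsLaw σ (fun _ => a) (fun _ => u) (fun _ => θ) N Φ {z | c ≤ ∑ k : Fin K, Bad.indicator (fun _ => (1 : ℝ)) (Φ.flow (t k) z)} ≤ ((K : ENNReal) * localGibbsLaw σ (fun _ => a) (fun _ => u) (fun _ => θ) N Φ Bad) / ENNReal.ofReal c :=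
  fun σ a θ u N Φ _Bad hBad _K t _c hc => measure_le_card_windows_mem_le σ a θ u N Φ hBad t hc

/-- **Markov over windows at rung 0, window-dependent bad events.**  Constant profiles, a flow `Φ`, measurable static
events `Bad k` (`k < K`), window start times `t : Fin K → ℝ`, a level `0 < c` and a common bound `G_N(Bad k) ≤ p`:
`G_N {z | c ≤ Σ_k 𝟙_{Bad k}(Φ_{t_k} z)} ≤ (K · p) / ofReal c` (invariance of `G_N` under each `Φ_{t_k}`; Markov). [folklore] -/
theorem measure_le_card_windows_mem_le' (σ a θ : ℝ) (u : V3) (N : ℕ)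
    (Φ : HardSphereFlow (Torus.geometry (Fin 3)) (hsDiameter σ N) (N + 1)) {K : ℕ}
    {Bad : Fin K → Set (Config (N + 1) (Fin 3) T3)} (hBad : ∀ k, MeasurableSet (Bad k)) (t : Fin K → ℝ)
    {p : ℝ≥0∞} (hp : ∀ k, localGibbsLaw σ (fun _ => a) (fun _ => u) (fun _ => θ) N Φ (Bad k) ≤ p)
    {c : ℝ} (hc : 0 < c) :
    localGibbsLaw σ (fun _ => a) (fun _ => u) (fun _ => θ) N Φ
        {z | c ≤ ∑ k : Fin K, (Bad k).indicator (fun _ => (1 : ℝ)) (Φ.flow (t k) z)} ≤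
      ((K : ℝ≥0∞) * p) / ENNReal.ofReal c := by
  classical
  set G := localGibbsLaw σ (fun _ => a) (fun _ => u) (fun _ => θ) N Φ with hG
  set F : Config (N + 1) (Fin 3) T3 → ℝ≥0∞ := fun z => ∑ k : Fin K, (Φ.flow (t k) ⁻¹' Bad k).indicator (fun _ => (1 : ℝ≥0∞)) z
    with hF
  have hpre : ∀ k : Fin K, MeasurableSet (Φ.flow (t k) ⁻¹' Bad k) := fun k => Φ.measurable_flow (t k) (hBad k)
  have hFm : Measurable F := Finset.measurable_sum _ fun k _ => measurable_one.indicator (hpre k)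
  -- its integral is `Σ_k G(Bad k) ≤ K p` by invariance
  have hFint : ∫⁻ z, F z ∂G ≤ K * p := by
    have h1 : ∫⁻ z, F z ∂G = ∑ k : Fin K, ∫⁻ z, (Φ.flow (t k) ⁻¹' Bad k).indicator (fun _ => (1 : ℝ≥0∞)) z ∂G :=
      lintegral_finsetSum Finset.univ (fun k _ => measurable_one.indicator (hpre k))
    have hk : ∀ k : Fin K, ∫⁻ z, (Φ.flow (t k) ⁻¹' Bad k).indicator (fun _ => (1 : ℝ≥0∞)) z ∂G ≤ p := fun k => by
      rw [lintegral_indicator (hpre k), setLIntegral_const, one_mul, hG,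
        localGibbsLaw_const_preimage_flow σ a θ u N Φ (t k) (hBad k)]
      exact hp k
    rw [h1]
    calc ∑ k : Fin K, ∫⁻ z, (Φ.flow (t k) ⁻¹' Bad k).indicator (fun _ => (1 : ℝ≥0∞)) z ∂G ≤ ∑ _k : Fin K, p :=
          Finset.sum_le_sum fun k _ => hk k
      _ = K * p := by rw [Finset.sum_const, Finset.card_univ, Fintype.card_fin, nsmul_eq_mul]
  -- the real count is the `toReal` of `F`, so the event is `{ofReal c ≤ F}`
  have hcount : ∀ z, ENNReal.ofReal (∑ k : Fin K, (Bad k).indicator (fun _ => (1 : ℝ)) (Φ.flow (t k) z)) = F z := by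
    intro z
    simp only [hF]
    rw [ENNReal.ofReal_sum_of_nonneg (fun k _ => Set.indicator_nonneg (fun _ _ => zero_le_one) _)]
    refine Finset.sum_congr rfl fun k _ => ?_
    by_cases hz : Φ.flow (t k) z ∈ Bad k
    · rw [Set.indicator_of_mem hz, Set.indicator_of_mem (show z ∈ Φ.flow (t k) ⁻¹' Bad k from hz), ENNReal.ofReal_one]
    · rw [Set.indicator_of_notMem hz, Set.indicator_of_notMem (show z ∉ Φ.flow (t k) ⁻¹' Bad k from hz),
        ENNReal.ofReal_zero]
  have hsub : {z | c ≤ ∑ k : Fin K, (Bad k).indicator (fun _ => (1 : ℝ)) (Φ.flow (t k) z)} ⊆ {z | ENNReal.ofReal c ≤ F z} := by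
    intro z hz
    simp only [mem_setOf_eq] at hz ⊢
    rw [← hcount z]
    exact ENNReal.ofReal_le_ofReal hz
  have hc' : ENNReal.ofReal c ≠ 0 := (ENNReal.ofReal_pos.2 hc).ne'
  calc G {z | c ≤ ∑ k : Fin K, (Bad k).indicator (fun _ => (1 : ℝ)) (Φ.flow (t k) z)}
      ≤ G {z | ENNReal.ofReal c ≤ F z} := measure_mono hsub
    _ ≤ (∫⁻ z, F z ∂G) / ENNReal.ofReal c := meas_ge_le_lintegral_div hFm.aemeasurable hc' ENNReal.ofReal_ne_top
    _ ≤ ((K : ℝ≥0∞) * p) / ENNReal.ofReal c := ENNReal.div_le_div_right hFint _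

end RateFloorMarkovWindows

end Summit.AtomisticToContinuum.HydrodynamicLimit.Theorems

end
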